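import Summits.QuantumFields.YangMills.Theorems.BalabanUVNodesN26BetaContMerged

/-!
# DAG node N26 — the (D4) socket at the β of record with the infinite-volume identification `hrep` REPLACED by a
# FINITE-VOLUME localized representation along the chain's own tori + NODE 00's named existence of the limit (1.21)

Cell `pub-ymgap`, YM-PLAN Track A (HUMAN RULING D-0062), seat `pub-ymgap-dag-n26-a` (gen 2; -a = KNIT-BY-NAME); third companion of
`BalabanUVNodesN26BetaContRecord` ∕ `BalabanUVNodesN26BetaContMerged`.  Those two files build the (D4)-chain inhabitant for the
record's definitional split from the located identity `hrep : polLimit F (k+1) (ℰ k p ·) ρ bV 0 1 z = Σ'_Y A1 k p Y z` (resp.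
`= P0 k z + Σ'_Y A1 k p Y z`) — an INFINITE-VOLUME statement ([I] p. 264: «This limit exists by the localized representation
(1.7)»).  But the chain's leaves ALREADY PROVE the limit passage for the leaf expansion: `Beta.RemainderLocalityHolo.PolLeavesTFacH.
tendsto_sum` — the torus-level leaf Hessian sums `Σ_{X : TDom 4 (N n)} E2n n X (proj 0) (proj z)` converge to `limKernel a z` as the
torus index `n → ∞` (dominated pull-back, `Beta.RemainderLimitTorusHolo`).  Hence `hrep` follows from two inputs of PRINTED TYPE AT
FINITE VOLUME plus NODE 00's NAMED existence property: (F) eventually along a cofinal family of approximations `Kn n → ∞` whose unit-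
lattice tori ARE the chain's tori, the windowed finite-volume polarisation kernel `polWindow F (Kn n) (k+1) (ℰ (Kn n)) ρ bV μ ν z` EQUALS
the chain's torus leaf sum — the localized representation (1.7) ∕ (4.37) AT FINITE VOLUME ([I] (1.7) p. 261 «𝐄^{(j)}(g, U) = Σ_Y
𝐄^{(j)}(g, Y, U)», (4.37) p. 291); (E) the full sequence `K ↦ polWindow F K …` converges — NODE 00's `PolLimitExists`-type clause
(`Node00.BetaOfRecord`; dag-ref-D READ-CARDS v0.9 «cite the limit's existence»).  Then `polLimit = limKernel` by uniqueness of
limits (`polLimit_eq_limKernel_of_finiteRep`), and the sockets of the companions fire (`atSlopeCont_betaOfTerms_of_finiteRep`,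
`atSlopeCont_betaOfMerged_of_finiteRep`, with their B4 ∕ N26-literal corollaries).  POINTER (no decl): the leaf records `hleaves k p hp`
are produced from an4's [II] step objects BY NAME by `Beta.RemainderStepAdapterHolo.toPolLeavesTFac190H_ofActivities` (torus family
`StepObjectD4 4 (N n)` + `Lemma3OnH` + seam ∕ (190) ∕ (1.7) data; consumer of record `Gaps.D4ScaleSlice.abs_beta1_le_of_stepObjects_at`) —
so (F) is then a statement about THOSE objects' torus leaf Hessians; for Bałaban's step the objects are NODE O's (instance 0∕1).

HONEST FRAMING.  Bookkeeping by name ([folklore] uniqueness of limits + the tree's `tendsto_sum`); NO estimate of Bałaban's series is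
proved; (F), (E), the leaves, `A1`, `P0`, the term families are PARAMETERS ∕ located inputs of NODE O and Stage ₈ (instance 0∕1);
N26 stays VACATED in the discharge form of record (closes WITH N25).  One finite four-torus programme at fixed ε per run; NOT ℝ⁴, NOT
infinite volume, NOT OS, NOT a mass gap, NOT Clay.  Sources (context): [I] = Balaban1987RG1 (1.7) p. 261, (1.20)–(1.22) p. 264,
(4.37) p. 291, (5.1) p. 292; [II] = Balaban1988RG2Cluster Lemma 3 (2.38) p. 20.  (v1.1, append-only: §4 — under (F) along the FULL
sequence of approximations clause (E) is a THEOREM, dag-ref-D READ #29 F-n26FR-3; header locator (4.37) corrected to p. 291, F-n26FR-1.)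
-/

noncomputable section

namespace Summit.QuantumFields.YangMills.Theorems.BalabanUVNodesN26FiniteRep

open Literature.MathematicalPhysics.QuantumFieldTheory.Balaban1983to89
open Literature.MathematicalPhysics.QuantumFieldTheory.Balaban1983to89.FlowStep
open Literature.MathematicalPhysics.QuantumFieldTheory.Balaban1983to89.T4Continuum (T4Family)
open Literature.MathematicalPhysics.QuantumFieldTheory.Balaban1983to89.Node00
open Literature.MathematicalPhysics.QuantumFieldTheory.Balaban1983to89.B13ScaleTransfer (Pt)
open Literature.MathematicalPhysics.QuantumFieldTheory.Balaban1983to89.TreeLengthTorus (TDom proj)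
open Literature.MathematicalPhysics.QuantumFieldTheory.Balaban1983to89.Beta.RemainderChainLattice
open Literature.MathematicalPhysics.QuantumFieldTheory.Balaban1983to89.Beta.RemainderLimitTorus (LDom limKernel)
open Literature.MathematicalPhysics.QuantumFieldTheory.Balaban1983to89.Beta.RemainderDecay190
open Literature.MathematicalPhysics.QuantumFieldTheory.Balaban1983to89.Beta.RemainderLocalityHolo (PolLeavesTFac190H)
open Summit.QuantumFields.BalabanUV.Gaps.BetaContFromD4Chain
open Summit.QuantumFields.YangMills.Theorems.BalabanUVNodesN26Record (atSlopeCont_betaOfTerms)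
open Summit.QuantumFields.YangMills.Theorems.BalabanUVNodesN26Merged (atSlopeCont_betaOfMerged)
open Filter Topology

variable {𝔄 : Type*} [NormedRing 𝔄] [NormedAlgebra ℝ 𝔄]
variable {V : Type*} [NormedAddCommGroup V] [NormedSpace ℝ V] {ι : Type*} [Fintype ι]
variable (F : T4Family) (ρ : V →L[ℝ] 𝔄) (bV : Module.Basis ι ℝ V)
variable {M : ℕ} [NeZero M] {c : B13.Consts} {ℓ α₂ : ℝ} {q : Consts190}

/-! ## §1 The infinite-volume identification from a finite-volume one + existence of the limit -/

/-- **`polLimit = limKernel` FROM FINITE VOLUME** ([folklore] uniqueness of limits ∘ the tree's `PolLeavesTFacH.tendsto_sum`): let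
`Lv` be a (190)-leaf record for the leaf kernel `a` (its tori `TPt 4 (Lv.N n · M)`, its leaf Hessians `Lv.E2n`), with the side
conditions `CondsL`, `R22gen`, `Valid`, `SignsL`.  If (F) eventually along a cofinal family `Kn n → ∞` of approximations the windowed
kernel of the term functionals `ℰ (Kn n)` EQUALS the torus leaf sum `Σ_X Lv.E2n n X (proj 0) (proj z)` at every site, and (E) the full
sequence `K ↦ polWindow F K j (ℰ K) ρ bV μ ν z` converges at every site, then `polLimit F j ℰ ρ bV μ ν z = limKernel a z` for every `z`.
[cite: Balaban1987RG1, (1.7) p.261, (1.21) p.264 and (5.1) p.292] -/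
theorem polLimit_eq_limKernel_of_finiteRep {j : ℕ} (ℰ : (K : ℕ) → (Fin (F.P K).d → Site (F.P K) j → 𝔄) → ℝ)
    {a : LDom 4 → Pt 4 → ℝ} (Lv : PolLeavesTFac190H 4 M a c ℓ α₂ q) (hC : CondsL 4 c ℓ) (h22 : c.R22gen ℓ)
    (hq : q.Valid c.δ₀) (hs : SignsL c α₂ q.B₃) {Kn : ℕ → ℕ} (hKn : Tendsto Kn atTop atTop) {μ ν : Fin 4}
    (hfin : ∀ᶠ n in atTop, ∀ z : Pt 4, polWindow F (Kn n) j (ℰ (Kn n)) ρ bV μ ν z =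
      ∑ X : TDom 4 (Lv.N n), Lv.E2n n X (proj (Lv.N n * M) 0) (proj (Lv.N n * M) z))
    (hex : ∀ z : Pt 4, ∃ P : ℝ, Tendsto (fun K : ℕ => polWindow F K j (ℰ K) ρ bV μ ν z) atTop (𝓝 P)) (z : Pt 4) :
    polLimit F j ℰ ρ bV μ ν z = limKernel a z := by
  obtain ⟨P, hP⟩ := hex z
  rw [polLimit_eq_of_tendsto F j ℰ ρ bV hP]
  have ht : Tendsto (fun n => ∑ X : TDom 4 (Lv.N n), Lv.E2n n X (proj (Lv.N n * M) 0) (proj (Lv.N n * M) z)) atTop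
      (𝓝 (limKernel a z)) :=
    ((Lv.toPolLeavesTFacH hq).tendsto_sum hC h22 hs z).2
  have hsub : Tendsto (fun n => polWindow F (Kn n) j (ℰ (Kn n)) ρ bV μ ν z) atTop (𝓝 (limKernel a z)) :=
    ht.congr' (hfin.mono fun n hn => (hn z).symm)
  exact tendsto_nhds_unique (hP.comp hKn) hsub

/-- The same with a history-free summand (design (β)): if the windowed kernel equals `P0n n z + Σ_X E2n …` eventually along `Kn`, the
finite-volume one-loop kernels converge `P0n n z → P0 z`, and (E) holds, then `polLimit … z = P0 z + limKernel a z`.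
[cite: Balaban1987RG1, (1.7) p.261, (2.12)-(2.13) p.268 and (5.1) p.292] -/
theorem polLimit_eq_add_limKernel_of_finiteRep {j : ℕ} (ℰ : (K : ℕ) → (Fin (F.P K).d → Site (F.P K) j → 𝔄) → ℝ)
    {a : LDom 4 → Pt 4 → ℝ} (Lv : PolLeavesTFac190H 4 M a c ℓ α₂ q) (hC : CondsL 4 c ℓ) (h22 : c.R22gen ℓ)
    (hq : q.Valid c.δ₀) (hs : SignsL c α₂ q.B₃) {Kn : ℕ → ℕ} (hKn : Tendsto Kn atTop atTop) {μ ν : Fin 4}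
    {P0 : Pt 4 → ℝ} (P0n : ℕ → Pt 4 → ℝ) (hP0 : ∀ z : Pt 4, Tendsto (fun n => P0n n z) atTop (𝓝 (P0 z)))
    (hfin : ∀ᶠ n in atTop, ∀ z : Pt 4, polWindow F (Kn n) j (ℰ (Kn n)) ρ bV μ ν z =
      P0n n z + ∑ X : TDom 4 (Lv.N n), Lv.E2n n X (proj (Lv.N n * M) 0) (proj (Lv.N n * M) z))
    (hex : ∀ z : Pt 4, ∃ P : ℝ, Tendsto (fun K : ℕ => polWindow F K j (ℰ K) ρ bV μ ν z) atTop (𝓝 P)) (z : Pt 4) :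
    polLimit F j ℰ ρ bV μ ν z = P0 z + limKernel a z := by
  obtain ⟨P, hP⟩ := hex z
  rw [polLimit_eq_of_tendsto F j ℰ ρ bV hP]
  have ht : Tendsto (fun n => P0n n z +
      ∑ X : TDom 4 (Lv.N n), Lv.E2n n X (proj (Lv.N n * M) 0) (proj (Lv.N n * M) z)) atTop (𝓝 (P0 z + limKernel a z)) :=
    (hP0 z).add ((Lv.toPolLeavesTFacH hq).tendsto_sum hC h22 hs z).2
  have hsub : Tendsto (fun n => polWindow F (Kn n) j (ℰ (Kn n)) ρ bV μ ν z) atTop (𝓝 (P0 z + limKernel a z)) :=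
    ht.congr' (hfin.mono fun n hn => (hn z).symm)
  exact tendsto_nhds_unique (hP.comp hKn) hsub

/-! ## §2 The sockets of the companions with `hrep` supplied from finite volume -/

section Sockets

variable (ℰ0 : TermFamily0 F 𝔄) (ℰ1 : TermFamily1 F 𝔄) {γ γ₀ : ℝ}

/-- **`AtSlopeCont` AT THE RECORD'S SPLIT (two-family shape) FROM FINITE VOLUME**: the hypotheses of
`BalabanUVNodesN26Record.atSlopeCont_betaOfTerms` with `hrep` REPLACED by (F) the finite-volume localized representation of the
remainder's windowed kernel by the chain's OWN torus leaf Hessians, eventually along cofinal approximations `Kn k p`, and (E) the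
existence of the limit (1.21) in the channel `(0, 1)` at every history of the box.  Every input declared; instance 0∕1.
[cite: Balaban1987RG1, (1.7) p.261 and (1.20)-(1.22) p.264; Balaban1988RG2Cluster, Lemma 3 (2.38) p.20] -/
theorem atSlopeCont_betaOfTerms_of_finiteRep (hle : γ₀ ≤ γ) {s : ℝ}
    (A1 : (k : ℕ) → (Fin (k + 1) → ℝ) → LDom 4 → Pt 4 → ℝ)
    (hleaves : ∀ k (p : Fin (k + 1) → ℝ), p ∈ Box γ₀ k → PolLeavesTFac190H 4 M (A1 k p) c ℓ α₂ q)
    (hC : CondsL 4 c ℓ) (h22 : c.R22gen ℓ) (hq : q.Valid c.δ₀) (hs : SignsL c α₂ q.B₃)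
    (hsmall : c.ε₁ * remCoeffL 4 M c α₂ q.B₃ ≤ s)
    (Kn : (k : ℕ) → (Fin (k + 1) → ℝ) → ℕ → ℕ)
    (hKn : ∀ k (p : Fin (k + 1) → ℝ), p ∈ Box γ₀ k → Tendsto (Kn k p) atTop atTop)
    (hfin : ∀ k (p : Fin (k + 1) → ℝ) (hp : p ∈ Box γ₀ k), ∀ᶠ n in atTop, ∀ z : Pt 4,
      polWindow F (Kn k p n) (k + 1) (ℰ1 k p (Kn k p n)) ρ bV 0 1 z =
        ∑ X : TDom 4 ((hleaves k p hp).N n), (hleaves k p hp).E2n n X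
          (proj ((hleaves k p hp).N n * M) 0) (proj ((hleaves k p hp).N n * M) z))
    (hex : ∀ k (p : Fin (k + 1) → ℝ), p ∈ Box γ₀ k → ∀ z : Pt 4, ∃ P : ℝ,
      Tendsto (fun K : ℕ => polWindow F K (k + 1) (ℰ1 k p K) ρ bV 0 1 z) atTop (𝓝 P))
    (hcont : ∀ k (z : Pt 4), ContinuousOn
      (fun p : Fin (k + 1) → ℝ => polLimit F (k + 1) (fun K => ℰ1 k p K) ρ bV 0 1 z) (Box γ₀ k)) :
    AtSlopeCont (oneLoopSplit_betaOfTerms F ℰ0 ℰ1 ρ bV γ) γ₀ s :=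
  atSlopeCont_betaOfTerms F ℰ0 ℰ1 ρ bV hle A1
    (fun k p hp z => polLimit_eq_limKernel_of_finiteRep F ρ bV (fun K => ℰ1 k p K) (hleaves k p hp) hC h22 hq hs
      (hKn k p hp) (hfin k p hp) (hex k p hp) z)
    hleaves hC h22 hq hs hsmall hcont

/-- **N26's LITERAL at the two-family β of record FROM FINITE VOLUME** (`γc := γ₀`, `0 < γ₀ ≤ γ` declared; B4 does not read the
smallness clause — `s := ε₁·K_rem,L`). [cite: Balaban1987RG1, (1.7) p.261, (1.22) p.264 and (5.10) p.293] -/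
theorem n26lit_betaOfTerms_of_finiteRep (hγ₀ : 0 < γ₀) (hle : γ₀ ≤ γ)
    (A1 : (k : ℕ) → (Fin (k + 1) → ℝ) → LDom 4 → Pt 4 → ℝ)
    (hleaves : ∀ k (p : Fin (k + 1) → ℝ), p ∈ Box γ₀ k → PolLeavesTFac190H 4 M (A1 k p) c ℓ α₂ q)
    (hC : CondsL 4 c ℓ) (h22 : c.R22gen ℓ) (hq : q.Valid c.δ₀) (hs : SignsL c α₂ q.B₃)
    (Kn : (k : ℕ) → (Fin (k + 1) → ℝ) → ℕ → ℕ)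
    (hKn : ∀ k (p : Fin (k + 1) → ℝ), p ∈ Box γ₀ k → Tendsto (Kn k p) atTop atTop)
    (hfin : ∀ k (p : Fin (k + 1) → ℝ) (hp : p ∈ Box γ₀ k), ∀ᶠ n in atTop, ∀ z : Pt 4,
      polWindow F (Kn k p n) (k + 1) (ℰ1 k p (Kn k p n)) ρ bV 0 1 z =
        ∑ X : TDom 4 ((hleaves k p hp).N n), (hleaves k p hp).E2n n X
          (proj ((hleaves k p hp).N n * M) 0) (proj ((hleaves k p hp).N n * M) z))
    (hex : ∀ k (p : Fin (k + 1) → ℝ), p ∈ Box γ₀ k → ∀ z : Pt 4, ∃ P : ℝ,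
      Tendsto (fun K : ℕ => polWindow F K (k + 1) (ℰ1 k p K) ρ bV 0 1 z) atTop (𝓝 P))
    (hcont : ∀ k (z : Pt 4), ContinuousOn
      (fun p : Fin (k + 1) → ℝ => polLimit F (k + 1) (fun K => ℰ1 k p K) ρ bV 0 1 z) (Box γ₀ k)) :
    ∃ γc : ℝ, 0 < γc ∧ BetaContH γc (betaOfTerms F ℰ0 ℰ1 ρ bV γ) :=
  ⟨γ₀, hγ₀, betaContH_of_atSlopeCont (atSlopeCont_betaOfTerms_of_finiteRep F ρ bV ℰ0 ℰ1 hle A1 hleaves hC h22 hq hs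
    le_rfl Kn hKn hfin hex hcont)⟩

/-- **`AtSlopeCont` AT THE MERGED β OF RECORD (design (β)) FROM FINITE VOLUME**: the hypotheses of
`BalabanUVNodesN26Merged.atSlopeCont_betaOfMerged` with `hrep` REPLACED by (F′) the finite-volume split of the merged windowed kernel
as finite-volume one-loop kernel `P0n k n` + the chain's torus leaf sum, eventually along `Kn k p`, the convergence `P0n k n z → P0 k z`,
and (E).  Every input declared; instance 0∕1. [cite: Balaban1987RG1, (1.7) p.261, (2.12)-(2.13) p.268 and (1.22) p.264] -/
theorem atSlopeCont_betaOfMerged_of_finiteRep (ℰ : TermFamily1 F 𝔄) (β0 : ℕ → ℝ) (hle : γ₀ ≤ γ) {s : ℝ}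
    (P0 : ℕ → Pt 4 → ℝ) (hβ0 : ∀ k, β0 k = B12Beta.secondMoment (fun _ _ => P0 k) 0 1)
    (hP0 : ∀ k, ∃ C δ₁ : ℝ, 0 < δ₁ ∧ B12Sec2to5.Decay510 (P0 k) C δ₁)
    (P0n : ℕ → ℕ → Pt 4 → ℝ) (hP0n : ∀ k (z : Pt 4), Tendsto (fun n => P0n k n z) atTop (𝓝 (P0 k z)))
    (A1 : (k : ℕ) → (Fin (k + 1) → ℝ) → LDom 4 → Pt 4 → ℝ)
    (hleaves : ∀ k (p : Fin (k + 1) → ℝ), p ∈ Box γ₀ k → PolLeavesTFac190H 4 M (A1 k p) c ℓ α₂ q)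
    (hC : CondsL 4 c ℓ) (h22 : c.R22gen ℓ) (hq : q.Valid c.δ₀) (hs : SignsL c α₂ q.B₃)
    (hsmall : c.ε₁ * remCoeffL 4 M c α₂ q.B₃ ≤ s)
    (Kn : (k : ℕ) → (Fin (k + 1) → ℝ) → ℕ → ℕ)
    (hKn : ∀ k (p : Fin (k + 1) → ℝ), p ∈ Box γ₀ k → Tendsto (Kn k p) atTop atTop)
    (hfin : ∀ k (p : Fin (k + 1) → ℝ) (hp : p ∈ Box γ₀ k), ∀ᶠ n in atTop, ∀ z : Pt 4,
      polWindow F (Kn k p n) (k + 1) (ℰ k p (Kn k p n)) ρ bV 0 1 z =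
        P0n k n z + ∑ X : TDom 4 ((hleaves k p hp).N n), (hleaves k p hp).E2n n X
          (proj ((hleaves k p hp).N n * M) 0) (proj ((hleaves k p hp).N n * M) z))
    (hex : ∀ k (p : Fin (k + 1) → ℝ), p ∈ Box γ₀ k → ∀ z : Pt 4, ∃ P : ℝ,
      Tendsto (fun K : ℕ => polWindow F K (k + 1) (ℰ k p K) ρ bV 0 1 z) atTop (𝓝 P))
    (hcont : ∀ k (z : Pt 4), ContinuousOn
      (fun p : Fin (k + 1) → ℝ => polLimit F (k + 1) (fun K => ℰ k p K) ρ bV 0 1 z) (Box γ₀ k)) :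
    AtSlopeCont (oneLoopSplit_betaOfMerged (betaMerged F ℰ ρ bV) β0 γ) γ₀ s :=
  atSlopeCont_betaOfMerged F ℰ ρ bV β0 hle P0 hβ0 hP0 A1
    (fun k p hp z => polLimit_eq_add_limKernel_of_finiteRep F ρ bV (fun K => ℰ k p K) (hleaves k p hp) hC h22 hq hs
      (hKn k p hp) (P0n k) (hP0n k) (hfin k p hp) (hex k p hp) z)
    hleaves hC h22 hq hs hsmall hcont

/-- **N26's LITERAL at the merged β of record FROM FINITE VOLUME** (`γc := γ₀`, `0 < γ₀ ≤ γ` declared).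
[cite: Balaban1987RG1, (1.7) p.261, (1.22) p.264 and (5.10) p.293] -/
theorem n26lit_betaOfMerged_of_finiteRep (ℰ : TermFamily1 F 𝔄) (β0 : ℕ → ℝ) (hγ₀ : 0 < γ₀) (hle : γ₀ ≤ γ)
    (P0 : ℕ → Pt 4 → ℝ) (hβ0 : ∀ k, β0 k = B12Beta.secondMoment (fun _ _ => P0 k) 0 1)
    (hP0 : ∀ k, ∃ C δ₁ : ℝ, 0 < δ₁ ∧ B12Sec2to5.Decay510 (P0 k) C δ₁)
    (P0n : ℕ → ℕ → Pt 4 → ℝ) (hP0n : ∀ k (z : Pt 4), Tendsto (fun n => P0n k n z) atTop (𝓝 (P0 k z)))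
    (A1 : (k : ℕ) → (Fin (k + 1) → ℝ) → LDom 4 → Pt 4 → ℝ)
    (hleaves : ∀ k (p : Fin (k + 1) → ℝ), p ∈ Box γ₀ k → PolLeavesTFac190H 4 M (A1 k p) c ℓ α₂ q)
    (hC : CondsL 4 c ℓ) (h22 : c.R22gen ℓ) (hq : q.Valid c.δ₀) (hs : SignsL c α₂ q.B₃)
    (Kn : (k : ℕ) → (Fin (k + 1) → ℝ) → ℕ → ℕ)
    (hKn : ∀ k (p : Fin (k + 1) → ℝ), p ∈ Box γ₀ k → Tendsto (Kn k p) atTop atTop)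
    (hfin : ∀ k (p : Fin (k + 1) → ℝ) (hp : p ∈ Box γ₀ k), ∀ᶠ n in atTop, ∀ z : Pt 4,
      polWindow F (Kn k p n) (k + 1) (ℰ k p (Kn k p n)) ρ bV 0 1 z =
        P0n k n z + ∑ X : TDom 4 ((hleaves k p hp).N n), (hleaves k p hp).E2n n X
          (proj ((hleaves k p hp).N n * M) 0) (proj ((hleaves k p hp).N n * M) z))
    (hex : ∀ k (p : Fin (k + 1) → ℝ), p ∈ Box γ₀ k → ∀ z : Pt 4, ∃ P : ℝ,
      Tendsto (fun K : ℕ => polWindow F K (k + 1) (ℰ k p K) ρ bV 0 1 z) atTop (𝓝 P))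
    (hcont : ∀ k (z : Pt 4), ContinuousOn
      (fun p : Fin (k + 1) → ℝ => polLimit F (k + 1) (fun K => ℰ k p K) ρ bV 0 1 z) (Box γ₀ k)) :
    ∃ γc : ℝ, 0 < γc ∧ BetaContH γc (betaOfMerged (betaMerged F ℰ ρ bV) β0 γ) :=
  ⟨γ₀, hγ₀, betaContH_of_atSlopeCont (atSlopeCont_betaOfMerged_of_finiteRep F ρ bV ℰ β0 hle P0 hβ0 hP0 P0n hP0n A1
    hleaves hC h22 hq hs le_rfl Kn hKn hfin hex hcont)⟩

end Sockets

/-! ## §3 Consistency of the finite-volume hypothesis list (audit A2 only) — the ZERO family with the zero leaves of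
`Beta.RemainderWitness` (whose torus leaf Hessians `E2n` vanish); HONESTY LABEL: the WRONG objects for Bałaban, nothing read through it -/

section Satisfiable

open Literature.MathematicalPhysics.QuantumFieldTheory.Balaban1983to89.Beta.RemainderLocalityHolo (PolLeavesTFac190H.ofAnalytic)
open Literature.MathematicalPhysics.QuantumFieldTheory.Balaban1983to89.Beta.RemainderWitness
  (c₀ q₀ zeroLeaves190 c₀_condsL c₀_R22gen c₀_activity_pos q₀_valid_c₀)
open Summit.QuantumFields.BalabanUV.Gaps (D4Residue.c₀_four_δ₀_pos)
open Summit.QuantumFields.YangMills.Theorems.BalabanUVNodesN26Record (polWindow_zero polLimit_zero)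

/-- **A2: the hypothesis list of `atSlopeCont_betaOfTerms_of_finiteRep` is jointly satisfiable, and the socket fires** — witnesses:
`ℰ¹ ≡ 0`, `A1 ≡ 0`, records `c₀ 4`, `ℓ := 2`, `α₂ := 1`, `q₀`, the zero leaves `zeroLeaves190` (torus leaf Hessians `E2n ≡ 0`, so (F)
reads `0 = Σ 0`), `Kn k p n := n`, (E) with limit `0`, (C-pt) trivially.  HONESTY LABEL: NOT Bałaban's objects (the zero-activity
witness GAPS §B excludes from every count); a satisfiability check of the typed hypotheses, instance count 0∕1 unchanged. -/
theorem finiteRep_hypotheses_satisfiable_zeroFamily (M : ℕ) [NeZero M] {γ γ₀ : ℝ} (hle : γ₀ ≤ γ) :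
    ∃ (ℰ1 : TermFamily1 F 𝔄) (A1 : (k : ℕ) → (Fin (k + 1) → ℝ) → LDom 4 → Pt 4 → ℝ) (c : B13.Consts) (ℓ α₂ : ℝ)
      (q : Consts190) (hleaves : ∀ k (p : Fin (k + 1) → ℝ), p ∈ Box γ₀ k → PolLeavesTFac190H 4 M (A1 k p) c ℓ α₂ q)
      (Kn : (k : ℕ) → (Fin (k + 1) → ℝ) → ℕ → ℕ),
      CondsL 4 c ℓ ∧ c.R22gen ℓ ∧ q.Valid c.δ₀ ∧ SignsL c α₂ q.B₃ ∧
      (∀ k (p : Fin (k + 1) → ℝ), p ∈ Box γ₀ k → Tendsto (Kn k p) atTop atTop) ∧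
      (∀ k (p : Fin (k + 1) → ℝ) (hp : p ∈ Box γ₀ k), ∀ᶠ n in atTop, ∀ z : Pt 4,
        polWindow F (Kn k p n) (k + 1) (ℰ1 k p (Kn k p n)) ρ bV 0 1 z =
          ∑ X : TDom 4 ((hleaves k p hp).N n), (hleaves k p hp).E2n n X
            (proj ((hleaves k p hp).N n * M) 0) (proj ((hleaves k p hp).N n * M) z)) ∧
      (∀ k (p : Fin (k + 1) → ℝ), p ∈ Box γ₀ k → ∀ z : Pt 4, ∃ P : ℝ,
        Tendsto (fun K : ℕ => polWindow F K (k + 1) (ℰ1 k p K) ρ bV 0 1 z) atTop (𝓝 P)) ∧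
      (∀ k (z : Pt 4), ContinuousOn
        (fun p : Fin (k + 1) → ℝ => polLimit F (k + 1) (fun K => ℰ1 k p K) ρ bV 0 1 z) (Box γ₀ k)) ∧
      ∀ ℰ0 : TermFamily0 F 𝔄,
        AtSlopeCont (oneLoopSplit_betaOfTerms F ℰ0 ℰ1 ρ bV γ) γ₀ (c.ε₁ * remCoeffL 4 M c α₂ q.B₃) := by
  have hA : 0 ≤ (c₀ 4).C3act * (c₀ 4).ε₁ := (c₀_activity_pos 4).le
  have hs : SignsL (c₀ 4) 1 q₀.B₃ := (q₀_valid_c₀ 4).signsL hA one_pos D4Residue.c₀_four_δ₀_pos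
  let Lv : PolLeavesTFac190H 4 M (fun (_ : LDom 4) (_ : Pt 4) => (0 : ℝ)) (c₀ 4) 2 1 q₀ :=
    PolLeavesTFac190H.ofAnalytic (zeroLeaves190 4 M (c₀ 4) 2 1 hA)
  have hE2 : ∀ n X x y, Lv.E2n n X x y = 0 := fun _ _ _ _ => rfl
  have hfin : ∀ (k : ℕ) (p : Fin (k + 1) → ℝ) (_ : p ∈ Box γ₀ k), ∀ᶠ n in atTop, ∀ z : Pt 4,
      polWindow F n (k + 1) (fun _ : Fin (F.P n).d → Site (F.P n) (k + 1) → 𝔄 => (0 : ℝ)) ρ bV 0 1 z =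
        ∑ X : TDom 4 (Lv.N n), Lv.E2n n X (proj (Lv.N n * M) 0) (proj (Lv.N n * M) z) :=
    fun k p _ => Eventually.of_forall fun n z => by
      rw [polWindow_zero]
      exact (Finset.sum_eq_zero fun X _ => hE2 n X _ _).symm
  have hex : ∀ (k : ℕ) (p : Fin (k + 1) → ℝ), p ∈ Box γ₀ k → ∀ z : Pt 4, ∃ P : ℝ,
      Tendsto (fun K : ℕ => polWindow F K (k + 1) (fun _ : Fin (F.P K).d → Site (F.P K) (k + 1) → 𝔄 => (0 : ℝ))
        ρ bV 0 1 z) atTop (𝓝 P) :=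
    fun k p _ z => ⟨0, by simp only [polWindow_zero]; exact tendsto_const_nhds⟩
  have hcont : ∀ k (z : Pt 4), ContinuousOn (fun p : Fin (k + 1) → ℝ =>
      polLimit F (k + 1) (fun K => fun _ : Fin (F.P K).d → Site (F.P K) (k + 1) → 𝔄 => (0 : ℝ)) ρ bV 0 1 z) (Box γ₀ k) :=
    fun k z => by simp only [polLimit_zero]; exact continuousOn_const
  refine ⟨fun _ _ _ _ => 0, fun _ _ _ _ => 0, c₀ 4, 2, 1, q₀, fun _ _ _ => Lv, fun _ _ n => n, c₀_condsL 4, c₀_R22gen 4,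
    q₀_valid_c₀ 4, hs, fun _ _ _ => tendsto_id, hfin, hex, hcont, fun ℰ0 => ?_⟩
  exact atSlopeCont_betaOfTerms_of_finiteRep F ρ bV ℰ0 (fun _ _ _ _ => 0) hle (fun _ _ _ _ => 0) (fun _ _ _ => Lv)
    (c₀_condsL 4) (c₀_R22gen 4) (q₀_valid_c₀ 4) hs le_rfl (fun _ _ n => n) (fun _ _ _ => tendsto_id) hfin hex hcont

end Satisfiable

/-! ## §4 (v1.1) Under (F) along the FULL sequence of approximations, (E) is a theorem (dag-ref-D READ #29, F-n26FR-3) -/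

section Full

variable (F : T4Family) (ρ : V →L[ℝ] 𝔄) (bV : Module.Basis ι ℝ V)
variable {M : ℕ} [NeZero M] {c : B13.Consts} {ℓ α₂ : ℝ} {q : Consts190}

/-- **(F) ALONG THE FULL SEQUENCE ⟹ (E)**: if the chain's tori are indexed by the approximation index itself (`Kn = id`: the `K`-th windowed
kernel equals the `K`-th torus leaf sum, eventually in `K` — the printed form of (1.7), which holds at EVERY finite volume), then the full sequence
`K ↦ polWindow F K j (ℰ K) ρ bV μ ν z` CONVERGES, to `limKernel a z` (`PolLeavesTFacH.tendsto_sum`); so clause (E) of §1 is then a theorem,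
not an input. [cite: Balaban1987RG1, (1.7) p.261, (1.21) p.264 and (5.1) p.292] -/
theorem tendsto_polWindow_of_finiteRep_full {j : ℕ} (ℰ : (K : ℕ) → (Fin (F.P K).d → Site (F.P K) j → 𝔄) → ℝ)
    {a : LDom 4 → Pt 4 → ℝ} (Lv : PolLeavesTFac190H 4 M a c ℓ α₂ q) (hC : CondsL 4 c ℓ) (h22 : c.R22gen ℓ)
    (hq : q.Valid c.δ₀) (hs : SignsL c α₂ q.B₃) {μ ν : Fin 4}
    (hfin : ∀ᶠ K in atTop, ∀ z : Pt 4, polWindow F K j (ℰ K) ρ bV μ ν z =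
      ∑ X : TDom 4 (Lv.N K), Lv.E2n K X (proj (Lv.N K * M) 0) (proj (Lv.N K * M) z)) (z : Pt 4) :
    Tendsto (fun K : ℕ => polWindow F K j (ℰ K) ρ bV μ ν z) atTop (𝓝 (limKernel a z)) :=
  ((Lv.toPolLeavesTFacH hq).tendsto_sum hC h22 hs z).2.congr' (hfin.mono fun _ hK => (hK z).symm)

/-- Hence, under (F) along the full sequence, `polLimit F j ℰ ρ bV μ ν z = limKernel a z` with NO existence input (§1's (E) discharged by
`tendsto_polWindow_of_finiteRep_full`). [cite: Balaban1987RG1, (1.7) p.261, (1.21) p.264 and (5.1) p.292] -/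
theorem polLimit_eq_limKernel_of_finiteRep_full {j : ℕ} (ℰ : (K : ℕ) → (Fin (F.P K).d → Site (F.P K) j → 𝔄) → ℝ)
    {a : LDom 4 → Pt 4 → ℝ} (Lv : PolLeavesTFac190H 4 M a c ℓ α₂ q) (hC : CondsL 4 c ℓ) (h22 : c.R22gen ℓ)
    (hq : q.Valid c.δ₀) (hs : SignsL c α₂ q.B₃) {μ ν : Fin 4}
    (hfin : ∀ᶠ K in atTop, ∀ z : Pt 4, polWindow F K j (ℰ K) ρ bV μ ν z =
      ∑ X : TDom 4 (Lv.N K), Lv.E2n K X (proj (Lv.N K * M) 0) (proj (Lv.N K * M) z)) (z : Pt 4) :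
    polLimit F j ℰ ρ bV μ ν z = limKernel a z :=
  polLimit_eq_of_tendsto F j ℰ ρ bV (tendsto_polWindow_of_finiteRep_full F ρ bV ℰ Lv hC h22 hq hs hfin z)

/-- And NODE 00's named existence property `PolLimitExists F j ℰ ρ bV` holds when (F) along the full sequence is available in EVERY channel
`(μ, ν)` (one leaf record per channel). [cite: Balaban1987RG1, (1.21) p.264] -/
theorem polLimitExists_of_finiteRep_full {j : ℕ} (ℰ : (K : ℕ) → (Fin (F.P K).d → Site (F.P K) j → 𝔄) → ℝ)
    (hC : CondsL 4 c ℓ) (h22 : c.R22gen ℓ) (hq : q.Valid c.δ₀) (hs : SignsL c α₂ q.B₃)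
    (a : Fin 4 → Fin 4 → LDom 4 → Pt 4 → ℝ) (Lv : (μ ν : Fin 4) → PolLeavesTFac190H 4 M (a μ ν) c ℓ α₂ q)
    (hfin : ∀ μ ν : Fin 4, ∀ᶠ K in atTop, ∀ z : Pt 4, polWindow F K j (ℰ K) ρ bV μ ν z =
      ∑ X : TDom 4 ((Lv μ ν).N K), (Lv μ ν).E2n K X (proj ((Lv μ ν).N K * M) 0) (proj ((Lv μ ν).N K * M) z)) :
    PolLimitExists F j ℰ ρ bV := fun μ ν z =>
  ⟨limKernel (a μ ν) z, tendsto_polWindow_of_finiteRep_full F ρ bV ℰ (Lv μ ν) hC h22 hq hs (hfin μ ν) z⟩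

end Full

end Summit.QuantumFields.YangMills.Theorems.BalabanUVNodesN26FiniteRep

end
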